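import Summits.Schanuel.Schanuel.Theorems.DiophantineDichotomyDefs

/-!
# Load-bearing hypotheses of the Lindemann–Weierstrass stubs of line `lw-small-height`
# (crux `KhovanskiiApproxType`, stmt-Schanuel-6116, negative lane)

The line's inputs `LWSmallHeight m` (module `Theorems/DiophantineDichotomyDefs.lean`; registered
stubs `stub_lwSmallHeight_one/two` of skeleton `Lines/lw-small-height.lean`) and `LWPenaltyMeasure`
(Ably 1994; stub `stub_lwPenaltyMeasure` of skeleton `Lines/height_window_compactness.lean`) assert
a decoupled codimension-one measure at `(e^{y₁},…,e^{y_m})` for `y` ALGEBRAIC and `ℚ`-LINEARLY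
INDEPENDENT.  This file (refuter, drefute pass; nothing here proves or refutes a Theses decl)
records, kernel-checked, that both hypotheses carry load and that the guard `1 ≤ m` does not:

* `no_lower_bound_at_root` — at a point where a non-zero integer polynomial vanishes there is no
  positive lower bound for `|P(ω)|` of ANY shape (so the witnesses below kill every penalty class:
  `CodimOneMeasure`, the Ably class `CodimOneMeasureX`, …);
* `lwSmallHeight_false_without_linIndep` — dropping linear independence: `y = 0 ∈ ℚ̄ᵐ` gives
  `e^{y} = (1,…,1)`, killed by `X₁ − 1` (every `m ≥ 1`);
* `lwSmallHeight_false_without_algebraic` — dropping algebraicity: `y = (log 2)` is `ℚ`-linearly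
  independent and `e^{y} = 2` is killed by `X₁ − 2`;
* `lwSmallHeight_zero` — `LWSmallHeight 0` holds (only non-zero constants are tested), so the
  hypothesis `1 ≤ m` of `LWPenaltyMeasure` is decoration, not content.
[folklore]
-/

noncomputable section

set_option linter.dupNamespace false

namespace Summit.Schanuel.Schanuel.Cruxes.KhovanskiiApproxType.Negative

open Summit.Schanuel.Schanuel.Cruxes.KhovanskiiApproxType.LwSmallHeight

/-- **No lower bound of any shape at a root.** If a non-zero `P₀ ∈ ℤ[X₁,…,X_m]` vanishes at
`ω`, no function `F > 0` bounds `‖P(ω)‖` from below over all non-zero `P`. [folklore] -/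
theorem no_lower_bound_at_root {m : ℕ} {ω : Fin m → ℂ} (P₀ : MvPolynomial (Fin m) ℤ)
    (hP₀ : P₀ ≠ 0) (h0 : MvPolynomial.aeval ω P₀ = 0) (F : MvPolynomial (Fin m) ℤ → ℝ)
    (hF : ∀ P, 0 < F P) : ¬ ∀ P : MvPolynomial (Fin m) ℤ, P ≠ 0 → F P ≤ ‖MvPolynomial.aeval ω P‖ := by
  intro h
  have h1 := h P₀ hP₀
  rw [h0, norm_zero] at h1
  exact absurd h1 (not_le.mpr (hF P₀))

/-- A root of a non-zero integer polynomial carries no decoupled codimension-one measure.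
[folklore] -/
theorem not_codimOneMeasure_of_root {m : ℕ} {ω : Fin m → ℂ} {μ K C : ℝ}
    (P₀ : MvPolynomial (Fin m) ℤ) (hP₀ : P₀ ≠ 0) (h0 : MvPolynomial.aeval ω P₀ = 0) :
    ¬ CodimOneMeasure m ω μ K C := by
  rintro ⟨-, h⟩
  exact no_lower_bound_at_root P₀ hP₀ h0 _ (fun P => Real.exp_pos _) h

/-- `LWSmallHeight m` with the hypothesis `LinearIndependent ℚ y` DROPPED. -/
def LWSmallHeightWithoutLinIndep (m : ℕ) : Prop :=
  ∀ y : Fin m → ℂ, (∀ i, IsAlgebraic ℚ (y i)) →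
    ∃ K C : ℝ, 0 ≤ K ∧ CodimOneMeasure m (Complex.exp ∘ y) (m : ℝ) K C

/-- `LWSmallHeight m` with the hypothesis `∀ i, IsAlgebraic ℚ (y i)` DROPPED. -/
def LWSmallHeightWithoutAlgebraic (m : ℕ) : Prop :=
  ∀ y : Fin m → ℂ, LinearIndependent ℚ y →
    ∃ K C : ℝ, 0 ≤ K ∧ CodimOneMeasure m (Complex.exp ∘ y) (m : ℝ) K C

/-- **Linear independence is load-bearing** in `LWSmallHeight m` / `LWPenaltyMeasure`
(every `m ≥ 1`): at the algebraic point `y = 0`, `e^{y} = (1,…,1)` is a root of `X₁ − 1`.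
[folklore] -/
theorem lwSmallHeight_false_without_linIndep (m : ℕ) (hm : 1 ≤ m) :
    ¬ LWSmallHeightWithoutLinIndep m := by
  intro h
  obtain ⟨K, C, -, hmeas⟩ := h (fun _ => 0) (fun _ => isAlgebraic_zero)
  refine not_codimOneMeasure_of_root (MvPolynomial.X ⟨0, hm⟩ - 1) ?_ ?_ hmeas
  · intro h0
    have := congrArg (MvPolynomial.eval fun _ : Fin m => (2 : ℤ)) h0
    norm_num at this
  · simp

/-- **Algebraicity is load-bearing** in `LWSmallHeight m` / `LWPenaltyMeasure`: the
`ℚ`-linearly independent transcendental point `y = (log 2)` has `e^{y} = 2`, a root of `X₁ − 2`.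
[folklore] -/
theorem lwSmallHeight_false_without_algebraic : ¬ LWSmallHeightWithoutAlgebraic 1 := by
  intro h
  have hli : LinearIndependent ℚ (fun _ : Fin 1 => ((Real.log 2 : ℝ) : ℂ)) := by
    refine linearIndependent_unique_iff.2 ?_
    have : Real.log 2 ≠ 0 := (Real.log_pos (by norm_num)).ne'
    exact_mod_cast this
  obtain ⟨K, C, -, hmeas⟩ := h _ hli
  refine not_codimOneMeasure_of_root (MvPolynomial.X 0 - 2) ?_ ?_ hmeas
  · intro h0
    have := congrArg (MvPolynomial.eval fun _ : Fin 1 => (3 : ℤ)) h0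
    norm_num at this
  · have h2 : Complex.exp ((Real.log 2 : ℝ) : ℂ) = 2 := by
      rw [← Complex.ofReal_exp, Real.exp_log (by norm_num : (0 : ℝ) < 2)]; norm_num
    rw [map_sub, MvPolynomial.aeval_X]
    simp only [Function.comp_apply]
    rw [h2]
    norm_num

/-- **The guard `1 ≤ m` is decoration**: `LWSmallHeight 0` holds — over `Fin 0` a non-zero
integer polynomial is a non-zero constant `c`, and `|c| ≥ 1 ≥ exp(−…)`. [folklore] -/
theorem lwSmallHeight_zero : LWSmallHeight 0 := by
  intro y _ _
  refine ⟨0, 1, le_rfl, one_pos, ?_⟩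
  intro P hP
  -- `P` is the constant `c = P.coeff 0 ≠ 0`
  set c : ℤ := P.coeff 0 with hcdef
  have hPc : P = MvPolynomial.C c := MvPolynomial.eq_C_of_isEmpty P
  have hc : c ≠ 0 := fun h => hP (by rw [hPc, h, map_zero])
  have hval : ‖MvPolynomial.aeval (Complex.exp ∘ y) P‖ = |((c : ℤ) : ℝ)| := by
    rw [hPc, MvPolynomial.aeval_C, algebraMap_int_eq, eq_intCast, Complex.norm_intCast]
  have h1 : (1 : ℝ) ≤ |((c : ℤ) : ℝ)| := by
    rw [← Int.cast_abs]; exact_mod_cast Int.one_le_abs hc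
  rw [hval]
  refine le_trans ?_ h1
  rw [Real.exp_le_one_iff, neg_nonpos, one_mul]
  have hA0 : (0 : ℝ) ≤ max 1 (P.totalDegree : ℝ) := le_trans zero_le_one (le_max_left _ _)
  have hlog : 0 ≤ Real.log (max 1 (mvNatHeight P : ℝ)) := Real.log_nonneg (le_max_left _ _)
  have h3 : 0 ≤ (max 1 (P.totalDegree : ℝ)) ^ (((0 : ℕ) : ℝ)) * Real.log (max 1 (mvNatHeight P : ℝ)) :=
    mul_nonneg (Real.rpow_nonneg hA0 _) hlog
  have h4 : 0 ≤ (max 1 (P.totalDegree : ℝ)) ^ (0 : ℝ) := Real.rpow_nonneg hA0 _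
  exact add_nonneg h3 h4

end Summit.Schanuel.Schanuel.Cruxes.KhovanskiiApproxType.Negative

end
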